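import Mathlib.Analysis.Normed.Module.HahnBanach
import Summits.QuantumFields.BalabanUV.T4Continuum.Support.NE9SliceSpaceOfRecord

/-!
# NE9ChannelReadingOfRecord — route R4's binder (B2) FROM THE END OF RECORD: the complexified, (1.36)-weight-divided channel
# reading of a one-creation-step slice as a bounded ℂ-LINEAR map `Rd m j s : 𝔜 →L[ℂ] Pot` on the slice space of record, with
# operator norm `≤ √2·τ m j` (hence `≤ (√2·τ̄)·ωⁿ` under the record's geometric weights), and its value on embedded real
# families (INTERFACE REQUEST NE9 (R4-4): the owner's docking of K2♭, part 2)

Cell `pub-balaban`, T4-DAG §6 NE9; BINDER row NE9 OWNER lineage `b2b-balaban-t4-ne9-p1` gen 60, CRUX PROVER NE9 (ruling e34b3e0c (2));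
route R4 «fading by Earle–Hamilton» (`t4/ROUTES-NE9.md` v4 §L1.0 EH1∕EH2, obligation (O-R4-1)); K2♭ instance leaf-04 g45
`NE9FutureProfileStep` (`readFamily`∕`injRead` from `Rd : ℕ → ℕ → (ℕ → ℝ) → (𝔜 →L[ℂ] Pot)`, `hRd : ‖Rd (j+n) j s‖ ≤ τ₀·ωⁿ`).

HONEST FRAMING (T4-DAG PAGE 1).  Rung (B)+1 of the FINITE-VOLUME T⁴ programme — NOT infinite volume, NOT a mass gap, NOT Clay.
NE9 (`T4OutputRate.NE9` ∧ `FadingMemory`) is a cell NEW ESTIMATE, NOT PRINTED in [I] = [Balaban1987RG1] (CMP **109**), [II] =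
[Balaban1988RG2Cluster] (CMP **116**), NOT PROVED for Bałaban's E^{(j)} («NE9 ⇐ the named binders»; WALLED ON A MODEL O-NE9-1; spine
0∕9).  HONEST DEPENDENCY (cell line, verbatim): continuum YM on T⁴ ⇐ BetaPertH ∧ nine spine estimates (0/9 proved); BetaPertH ⇐
(D1) ∧ (D4) ∧ CAP+tail; G-an2-4 gates asym, D1 and NE2/3/4.  `FlowStep.BetaPertH`, (B), (B^μ) do not occur.  Generic functional
analysis over the BINDER SHAPES of `T4HistoryLipschitzRecursion`; data definitions only (no `def … : Prop`); [II] for TYPES only.  0 sorry.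

WHAT IS BUILT (all [folklore]; displayed hypotheses = the END of record's binders `hadd`∕`hres`∕`hstep` + «`Adm` closed under
real scalars» `hsmul`, nonemptiness, positive weights, `0 ≤ τ m j`): §1 `restrictScale` algebra (`_add'`, `_zero'`, parts of complex multiples) and the profile of restricted parts;
§2 **`rdFun`** (entries `(wt m y)⁻¹·(T m s (reF G)↾j y + i·T m s (imF G)↾j y)`), **`norm_rdFun_apply_le`** (`≤ √2·τ m j·‖G‖`),
`rdFun_add`, `rdFun_smul` (via `NE9ChannelRealLinear`); §3 **`Rd m j hjm s : ↥(sliceSub κ Adm …) →L[ℂ] lp (ι → ℂ) ∞`**, `norm_Rd_le`,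
the total family **`RdOf`** and **`norm_RdOf_le_geometric`** (`τ m j ≤ τ̄·ω^{m−j}` ⇒ `‖RdOf (j+n) j s‖ ≤ (√2·τ̄)·ωⁿ` = K2♭'s `hRd`
with `τ₀ := √2·τ̄`); §4 **`Rd_embR_apply`** (on an embedded real admissible family the reading is the record's REAL weighted table
`T m s (H↾j) y ∕ wt m y` — `NE9TableReading`'s entries); §5 **`extCLM p A`** — ℓ^∞(ι, ℂ) is INJECTIVE: a bounded linear map into
it extends from a subspace to the whole space with the same norm bound (coordinatewise Hahn–Banach `exists_extension_norm_eq`,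
re-packed); §6 **`RdAmb m j s`** — the readings on the CLOSED AMBIENT space `lp (Bg × C.Dom → ℂ) ∞` (so route R4's 𝔜 can be
complete and NO closedness of `Adm` is needed for Fréchet holomorphy into 𝔜), `norm_RdAmb_le_geometric`, `RdAmb_apply_coe`,
**`RdAmb_embR_apply`**.  DISGUISE TEST: one channel, one slice, linear algebra and norm bounds; no activity, no species; not NE9.

References (TYPES only): [Balaban1988RG2Cluster] T. Bałaban, CMP **116** (1988) 1–22 — (1.23) p. 7, p. 8 l. 9–10, (1.33)∕(1.36) p. 9.
Summits-side NEW work (LEAN PLACEMENT RULE); imports `NE9SliceSpaceOfRecord` + Mathlib Hahn–Banach BY NAME; modifies nothing; 0 sorry.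
Value = route R4's binder (B2) at the record level modulo the END of record's own structural binders, NOT summit progress.
-/

noncomputable section

namespace Summit.QuantumFields.BalabanUV.T4Continuum.NE9ChannelReadingOfRecord

open scoped ENNReal
open Literature.MathematicalPhysics.QuantumFieldTheory.Balaban1983to89
open Literature.MathematicalPhysics.QuantumFieldTheory.Balaban1983to89.T4OutputRate
open Literature.MathematicalPhysics.QuantumFieldTheory.Balaban1983to89.T4HistoryLipschitzRecursion
open Summit.QuantumFields.BalabanUV.T4Continuum.NE9ChannelRealLinear
open Summit.QuantumFields.BalabanUV.T4Continuum.NE9SliceSpaceOfRecord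

variable {C : Carriers} {Bg ι : Type}

/-! ## §1 One-creation-step restrictions: algebra, support, profile -/

/-- [folklore] `restrictScale` is additive. -/
theorem restrictScale_add' (j : ℕ) (H H' : Bg → C.Dom → ℝ) :
    restrictScale j (H + H') = restrictScale j H + restrictScale j H' := by
  funext U X
  by_cases h : C.scale X = j
  · simp only [Pi.add_apply, restrictScale_of_eq _ h]
  · simp only [Pi.add_apply, restrictScale_of_ne _ h, add_zero]

/-- [folklore] `restrictScale j 0 = 0`. -/
theorem restrictScale_zero' (j : ℕ) : restrictScale (C := C) j (0 : Bg → C.Dom → ℝ) = 0 := by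
  funext U X
  by_cases h : C.scale X = j
  · simp only [restrictScale_of_eq _ h, Pi.zero_apply]
  · simp only [restrictScale_of_ne _ h, Pi.zero_apply]

/-- [folklore] The restriction is SUPPORTED at its creation step. -/
theorem restrictScale_supported (j : ℕ) (H : Bg → C.Dom → ℝ) :
    ∀ (U : Bg) (X : C.Dom), C.scale X ≠ j → restrictScale j H U X = 0 := fun _ _ hX => restrictScale_of_ne H hX
/-- [folklore] The restricted REAL part of a complex multiple: `(reF (z•G))↾j = z.re•(reF G)↾j − z.im•(imF G)↾j`. -/
theorem restrictScale_reF_smul (κ : ℝ) (j : ℕ) (z : ℂ) (G : lp (fun _ : Bg × C.Dom => ℂ) ∞) :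
    restrictScale j (reF κ (z • G)) = z.re • restrictScale j (reF κ G) - z.im • restrictScale j (imF κ G) := by
  rw [reF_smul]
  funext U X
  by_cases h : C.scale X = j
  · simp only [Pi.sub_apply, Pi.smul_apply, restrictScale_of_eq _ h]
  · simp only [Pi.sub_apply, Pi.smul_apply, restrictScale_of_ne _ h, smul_zero, sub_zero]

/-- [folklore] The restricted IMAGINARY part of a complex multiple: `(imF (z•G))↾j = z.re•(imF G)↾j + z.im•(reF G)↾j`. -/
theorem restrictScale_imF_smul (κ : ℝ) (j : ℕ) (z : ℂ) (G : lp (fun _ : Bg × C.Dom => ℂ) ∞) :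
    restrictScale j (imF κ (z • G)) = z.re • restrictScale j (imF κ G) + z.im • restrictScale j (reF κ G) := by
  rw [imF_smul]
  funext U X
  by_cases h : C.scale X = j
  · simp only [Pi.add_apply, Pi.smul_apply, restrictScale_of_eq _ h]
  · simp only [Pi.add_apply, Pi.smul_apply, restrictScale_of_ne _ h, smul_zero, add_zero]

/-- [folklore] THE PROFILE OF THE RESTRICTED REAL PART of a slice-space element at its creation step:
`|(reF κ G)↾j U X| ≤ e^{−κd(X)}·‖G‖` on `scale X = j`. -/
theorem abs_restrictScale_reF_le (κ : ℝ) (G : lp (fun _ : Bg × C.Dom => ℂ) ∞) (j : ℕ) :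
    ∀ (U : Bg) (X : C.Dom), C.scale X = j → |restrictScale j (reF κ G) U X| ≤ Real.exp (-(κ * C.d X)) * ‖G‖ :=
  fun U X hX => by rw [restrictScale_of_eq _ hX]; exact abs_reF_le κ G U X

/-- [folklore] The same for the imaginary part. -/
theorem abs_restrictScale_imF_le (κ : ℝ) (G : lp (fun _ : Bg × C.Dom => ℂ) ∞) (j : ℕ) :
    ∀ (U : Bg) (X : C.Dom), C.scale X = j → |restrictScale j (imF κ G) U X| ≤ Real.exp (-(κ * C.d X)) * ‖G‖ :=
  fun U X hX => by rw [restrictScale_of_eq _ hX]; exact abs_imF_le κ G U X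

/-! ## §2 The entries of the complexified weighted channel reading -/

section Entries

variable (κ : ℝ) (T : ℕ → (ℕ → ℝ) → (Bg → C.Dom → ℝ) → ι → ℝ) (wt : ℕ → ι → ℝ)

/-- **THE ENTRIES OF THE READING** (route R4 EH1∕EH2's `ρ(T m s E)` for a complex scale-`j` slice `E`): at the output index `y`,
`(wt m y)⁻¹·(T m s (reF G)↾j y + i·T m s (imF G)↾j y)` — the canonical complexification of the channel on the one-step restrictions
of the parts, divided by the (1.36) weight. [cite: Balaban1988RG2Cluster, (1.33) and (1.36) p.9] -/
def rdFun (m j : ℕ) (s : ℕ → ℝ) (G : lp (fun _ : Bg × C.Dom => ℂ) ∞) : ι → ℂ :=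
  fun y => ((wt m y)⁻¹ : ℂ) * ⟨T m s (restrictScale j (reF κ G)) y, T m s (restrictScale j (imF κ G)) y⟩

/-- [folklore] `rdFun` unfolds. -/
@[simp] theorem rdFun_apply (m j : ℕ) (s : ℕ → ℝ) (G : lp (fun _ : Bg × C.Dom => ℂ) ∞) (y : ι) :
    rdFun κ T wt m j s G y =
      ((wt m y)⁻¹ : ℂ) * ⟨T m s (restrictScale j (reF κ G)) y, T m s (restrictScale j (imF κ G)) y⟩ := rfl

variable {κ T wt} {Adm : Set (Bg → C.Dom → ℝ)} {τ : ℕ → ℕ → ℝ}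

/-- **THE ENTRY BOUND**: for a slice-space element `G` (parts admissible), `j ≤ m`, positive weights and the END of record's binders
`AdmRestrict` + `ChannelSizeAtStepNN`: `‖rdFun κ T wt m j s G y‖ ≤ √2·τ m j·‖G‖`.
[cite: Balaban1988RG2Cluster, p.8 l.9-10 and (1.36) p.9] -/
theorem norm_rdFun_apply_le (hres : AdmRestrict Adm) (hstep : ChannelSizeAtStepNN Adm T κ wt τ)
    (hwt : ∀ m y, 0 < wt m y) {G : lp (fun _ : Bg × C.Dom => ℂ) ∞} (hre : reF κ G ∈ Adm) (him : imF κ G ∈ Adm)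
    {m j : ℕ} (hjm : j ≤ m) (s : ℕ → ℝ) (y : ι) : ‖rdFun κ T wt m j s G y‖ ≤ Real.sqrt 2 * τ m j * ‖G‖ := by
  have hw := hwt m y
  have key := norm_channel_complex_le_atStep hstep (hres.1 _ hre j) (hres.1 _ him j) hjm s
    (restrictScale_supported j _) (restrictScale_supported j _) (norm_nonneg G) (abs_restrictScale_reF_le κ G j)
    (abs_restrictScale_imF_le κ G j) y
  rw [rdFun_apply, norm_mul, norm_inv, Complex.norm_real, Real.norm_of_nonneg hw.le]
  calc (wt m y)⁻¹ * ‖(⟨T m s (restrictScale j (reF κ G)) y, T m s (restrictScale j (imF κ G)) y⟩ : ℂ)‖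
      ≤ (wt m y)⁻¹ * (Real.sqrt 2 * (wt m y * (τ m j * ‖G‖))) := mul_le_mul_of_nonneg_left key (inv_nonneg.mpr hw.le)
    _ = Real.sqrt 2 * τ m j * ‖G‖ := by field_simp

/-- **ADDITIVITY OF THE ENTRIES** on the slice space (parts admissible). [folklore] -/
theorem rdFun_add (hadd : ChannelAdditive Adm T) (hres : AdmRestrict Adm)
    (hsub : ∀ H₁ ∈ Adm, ∀ H₂ ∈ Adm, H₁ - H₂ ∈ Adm) (hsmul : ∀ (c : ℝ), ∀ H ∈ Adm, c • H ∈ Adm)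
    {G G' : lp (fun _ : Bg × C.Dom => ℂ) ∞} (hre : reF κ G ∈ Adm) (him : imF κ G ∈ Adm) (hre' : reF κ G' ∈ Adm)
    (him' : imF κ G' ∈ Adm) (m j : ℕ) (s : ℕ → ℝ) :
    rdFun κ T wt m j s (G + G') = rdFun κ T wt m j s G + rdFun κ T wt m j s G' := by
  funext y
  rw [Pi.add_apply, rdFun_apply, rdFun_apply, rdFun_apply, reF_add, imF_add, restrictScale_add', restrictScale_add',
    channel_complex_add hadd hsub hsmul (hres.1 _ hre j) (hres.1 _ him j) (hres.1 _ hre' j) (hres.1 _ him' j) m s y, mul_add]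

/-- **ℂ-HOMOGENEITY OF THE ENTRIES** on the slice space (parts admissible; `j ≤ m`): `rdFun (z•G) = z•rdFun G` — the channel's
ℝ-linearity on one-step slices (`NE9ChannelRealLinear.channel_complex_linear_atStep`) read through `reF (z•G) = z.re•reF G −
z.im•imF G`, `imF (z•G) = z.re•imF G + z.im•reF G`. [folklore] -/
theorem rdFun_smul (hadd : ChannelAdditive Adm T) (hres : AdmRestrict Adm) (hstep : ChannelSizeAtStepNN Adm T κ wt τ)
    (hsub : ∀ H₁ ∈ Adm, ∀ H₂ ∈ Adm, H₁ - H₂ ∈ Adm) (hsmul : ∀ (c : ℝ), ∀ H ∈ Adm, c • H ∈ Adm)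
    {G : lp (fun _ : Bg × C.Dom => ℂ) ∞} (hre : reF κ G ∈ Adm) (him : imF κ G ∈ Adm) {m j : ℕ} (hjm : j ≤ m)
    (s : ℕ → ℝ) (z : ℂ) : rdFun κ T wt m j s (z • G) = z • rdFun κ T wt m j s G := by
  funext y
  have key := channel_complex_linear_atStep hadd hstep hsub hsmul (hres.1 _ hre j) (hres.1 _ him j) hjm s
    (restrictScale_supported j _) (restrictScale_supported j _) (norm_nonneg G) (norm_nonneg G)
    (abs_restrictScale_reF_le κ G j) (abs_restrictScale_imF_le κ G j) z.re z.im y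
  rw [Pi.smul_apply, rdFun_apply, rdFun_apply, restrictScale_reF_smul, restrictScale_imF_smul, key, Complex.eta, smul_eq_mul]
  ring

/-- [folklore] The entries are bounded: `rdFun … G ∈ ℓ^∞(ι, ℂ)`. -/
theorem memℓp_rdFun (hres : AdmRestrict Adm) (hstep : ChannelSizeAtStepNN Adm T κ wt τ) (hwt : ∀ m y, 0 < wt m y)
    {G : lp (fun _ : Bg × C.Dom => ℂ) ∞} (hre : reF κ G ∈ Adm) (him : imF κ G ∈ Adm) {m j : ℕ} (hjm : j ≤ m)
    (s : ℕ → ℝ) : Memℓp (rdFun κ T wt m j s G) ∞ :=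
  memℓp_infty ⟨Real.sqrt 2 * τ m j * ‖G‖, by
    rintro _ ⟨y, rfl⟩
    exact norm_rdFun_apply_le hres hstep hwt hre him hjm s y⟩

end Entries

/-! ## §3 The reading as a bounded ℂ-linear map on the slice space of record -/

section CLM

variable (κ : ℝ) (T : ℕ → (ℕ → ℝ) → (Bg → C.Dom → ℝ) → ι → ℝ) (wt : ℕ → ι → ℝ) (Adm : Set (Bg → C.Dom → ℝ))
  (τ : ℕ → ℕ → ℝ)

/-- **THE READING `Rd m j s : 𝔜 →L[ℂ] Pot`** (route R4 EH2's `ρ ∘ T (k+1+n) s` on scale-`(k+1)` slices; K2♭ §6's letter): on the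
slice space of record `𝔜 = ↥(sliceSub κ Adm …)`, the complexified weight-divided channel reading of the scale-`j` restriction,
valued in `Pot = lp (fun _ : ι => ℂ) ∞`, for `j ≤ m`; bounded by `√2·τ m j` (§2).  Hypotheses = the END of record's binders
`ChannelAdditive`, `AdmRestrict`, `ChannelSizeAtStepNN` + «`Adm` closed under differences and real scalars, nonempty» + positive
weights + `0 ≤ τ m j`. [cite: Balaban1988RG2Cluster, (1.33) and (1.36) p.9] -/
def Rd (hadd : ChannelAdditive Adm T) (hres : AdmRestrict Adm) (hstep : ChannelSizeAtStepNN Adm T κ wt τ)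
    (hsub : ∀ H₁ ∈ Adm, ∀ H₂ ∈ Adm, H₁ - H₂ ∈ Adm) (hsmul : ∀ (c : ℝ), ∀ H ∈ Adm, c • H ∈ Adm) (hne : Adm.Nonempty)
    (hwt : ∀ m y, 0 < wt m y) (m j : ℕ) (hjm : j ≤ m) (hτ : 0 ≤ τ m j) (s : ℕ → ℝ) :
    sliceSub κ Adm hsub hsmul hne →L[ℂ] lp (fun _ : ι => ℂ) ∞ :=
  LinearMap.mkContinuous
    { toFun := fun G => ⟨rdFun κ T wt m j s (G : lp (fun _ : Bg × C.Dom => ℂ) ∞), memℓp_rdFun hres hstep hwt G.2.1 G.2.2 hjm s⟩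
      map_add' := fun G G' => by
        ext y
        simp only [Submodule.coe_add, lp.coeFn_add, Pi.add_apply]
        rw [rdFun_add hadd hres hsub hsmul G.2.1 G.2.2 G'.2.1 G'.2.2 m j s, Pi.add_apply]
      map_smul' := fun z G => by
        ext y
        simp only [Submodule.coe_smul, lp.coeFn_smul, Pi.smul_apply, RingHom.id_apply]
        rw [rdFun_smul hadd hres hstep hsub hsmul G.2.1 G.2.2 hjm s z, Pi.smul_apply] }
    (Real.sqrt 2 * τ m j) fun G => by
      refine lp.norm_le_of_forall_le (mul_nonneg (mul_nonneg (Real.sqrt_nonneg _) hτ) (norm_nonneg _)) fun y => ?_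
      exact norm_rdFun_apply_le hres hstep hwt G.2.1 G.2.2 hjm s y

/-- **THE TOTAL FAMILY OF READINGS** `RdOf : ℕ → ℕ → (ℕ → ℝ) → (𝔜 →L[ℂ] Pot)` — `Rd m j s` for `j ≤ m`, the zero map for
`j > m` (a step never reads terms created later; K2♭ only files `Rd (j+n) j s`). [folklore] -/
def RdOf (hadd : ChannelAdditive Adm T) (hres : AdmRestrict Adm) (hstep : ChannelSizeAtStepNN Adm T κ wt τ)
    (hsub : ∀ H₁ ∈ Adm, ∀ H₂ ∈ Adm, H₁ - H₂ ∈ Adm) (hsmul : ∀ (c : ℝ), ∀ H ∈ Adm, c • H ∈ Adm) (hne : Adm.Nonempty)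
    (hwt : ∀ m y, 0 < wt m y) (hτ : ∀ m j, j ≤ m → 0 ≤ τ m j) (m j : ℕ) (s : ℕ → ℝ) :
    sliceSub κ Adm hsub hsmul hne →L[ℂ] lp (fun _ : ι => ℂ) ∞ :=
  if hjm : j ≤ m then Rd κ T wt Adm τ hadd hres hstep hsub hsmul hne hwt m j hjm (hτ m j hjm) s else 0

variable {κ T wt Adm τ}

/-- [folklore] The entries of `Rd`. -/
theorem Rd_apply_coe {hadd : ChannelAdditive Adm T} {hres : AdmRestrict Adm} {hstep : ChannelSizeAtStepNN Adm T κ wt τ}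
    {hsub : ∀ H₁ ∈ Adm, ∀ H₂ ∈ Adm, H₁ - H₂ ∈ Adm} {hsmul : ∀ (c : ℝ), ∀ H ∈ Adm, c • H ∈ Adm} {hne : Adm.Nonempty}
    {hwt : ∀ m y, 0 < wt m y} {m j : ℕ} {hjm : j ≤ m} {hτ : 0 ≤ τ m j} {s : ℕ → ℝ} (G : sliceSub κ Adm hsub hsmul hne) (y : ι) :
    (Rd κ T wt Adm τ hadd hres hstep hsub hsmul hne hwt m j hjm hτ s G : ι → ℂ) y =
      rdFun κ T wt m j s (G : lp (fun _ : Bg × C.Dom => ℂ) ∞) y := rfl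

/-- **`‖Rd m j s‖ ≤ √2·τ m j`.** [cite: Balaban1988RG2Cluster, p.8 l.9-10 and (1.36) p.9] -/
theorem norm_Rd_le {hadd : ChannelAdditive Adm T} {hres : AdmRestrict Adm} {hstep : ChannelSizeAtStepNN Adm T κ wt τ}
    {hsub : ∀ H₁ ∈ Adm, ∀ H₂ ∈ Adm, H₁ - H₂ ∈ Adm} {hsmul : ∀ (c : ℝ), ∀ H ∈ Adm, c • H ∈ Adm} {hne : Adm.Nonempty}
    {hwt : ∀ m y, 0 < wt m y} {m j : ℕ} {hjm : j ≤ m} {hτ : 0 ≤ τ m j} {s : ℕ → ℝ} :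
    ‖Rd κ T wt Adm τ hadd hres hstep hsub hsmul hne hwt m j hjm hτ s‖ ≤ Real.sqrt 2 * τ m j :=
  LinearMap.mkContinuous_norm_le _ (mul_nonneg (Real.sqrt_nonneg _) hτ) _

/-- [folklore] `RdOf` is `Rd` for `j ≤ m`. -/
theorem RdOf_of_le {hadd : ChannelAdditive Adm T} {hres : AdmRestrict Adm} {hstep : ChannelSizeAtStepNN Adm T κ wt τ}
    {hsub : ∀ H₁ ∈ Adm, ∀ H₂ ∈ Adm, H₁ - H₂ ∈ Adm} {hsmul : ∀ (c : ℝ), ∀ H ∈ Adm, c • H ∈ Adm} {hne : Adm.Nonempty}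
    {hwt : ∀ m y, 0 < wt m y} {hτ : ∀ m j, j ≤ m → 0 ≤ τ m j} {m j : ℕ} (hjm : j ≤ m) (s : ℕ → ℝ) :
    RdOf κ T wt Adm τ hadd hres hstep hsub hsmul hne hwt hτ m j s =
      Rd κ T wt Adm τ hadd hres hstep hsub hsmul hne hwt m j hjm (hτ m j hjm) s := by
  rw [RdOf, dif_pos hjm]

/-- **K2♭'s BINDER (B2) FROM THE RECORD's GEOMETRIC WEIGHTS**: `τ m j ≤ τ̄·ω^{m−j}` for `j ≤ m` (the END of record's `hτ`) ⇒
`‖RdOf (j+n) j s‖ ≤ (√2·τ̄)·ωⁿ` — `hRd` with `τ₀ := √2·τ̄`. [cite: Balaban1988RG2Cluster, p.8 l.9-10 and (1.36) p.9] -/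
theorem norm_RdOf_le_geometric {hadd : ChannelAdditive Adm T} {hres : AdmRestrict Adm}
    {hstep : ChannelSizeAtStepNN Adm T κ wt τ} {hsub : ∀ H₁ ∈ Adm, ∀ H₂ ∈ Adm, H₁ - H₂ ∈ Adm}
    {hsmul : ∀ (c : ℝ), ∀ H ∈ Adm, c • H ∈ Adm} {hne : Adm.Nonempty} {hwt : ∀ m y, 0 < wt m y}
    {hτ : ∀ m j, j ≤ m → 0 ≤ τ m j} {τbar ω : ℝ} (hgeom : ∀ m j, j ≤ m → τ m j ≤ τbar * ω ^ (m - j)) (j n : ℕ)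
    (s : ℕ → ℝ) : ‖RdOf κ T wt Adm τ hadd hres hstep hsub hsmul hne hwt hτ (j + n) j s‖ ≤ Real.sqrt 2 * τbar * ω ^ n := by
  rw [RdOf_of_le (Nat.le_add_right j n)]
  refine norm_Rd_le.trans ?_
  have h := hgeom (j + n) j (Nat.le_add_right j n)
  rw [Nat.add_sub_cancel_left] at h
  calc Real.sqrt 2 * τ (j + n) j ≤ Real.sqrt 2 * (τbar * ω ^ n) := mul_le_mul_of_nonneg_left h (Real.sqrt_nonneg _)
    _ = Real.sqrt 2 * τbar * ω ^ n := by ring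

end CLM

/-! ## §4 The reading on embedded real families: the record's real weighted table -/

/-- **AT ACTUAL STATES THE READING IS THE RECORD's REAL WEIGHTED TABLE**: for a real admissible family `H` of finite decay-weighted
size, the reading of its embedding has the entries `T m s (H↾j) y ∕ wt m y` (no imaginary part) — route R4 EH1's
`x(n,s) = ω̂^{−n}·ρ(T … s …)` with `ρ` = the END of record's weight-divided reading (`NE9TableReading`), per creation step. [folklore] -/
theorem Rd_embR_apply {κ : ℝ} {T : ℕ → (ℕ → ℝ) → (Bg → C.Dom → ℝ) → ι → ℝ} {wt : ℕ → ι → ℝ}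
    {Adm : Set (Bg → C.Dom → ℝ)} {τ : ℕ → ℕ → ℝ} {hadd : ChannelAdditive Adm T} {hres : AdmRestrict Adm}
    {hstep : ChannelSizeAtStepNN Adm T κ wt τ} {hsub : ∀ H₁ ∈ Adm, ∀ H₂ ∈ Adm, H₁ - H₂ ∈ Adm}
    {hsmul : ∀ (c : ℝ), ∀ H ∈ Adm, c • H ∈ Adm} {hne : Adm.Nonempty} {hwt : ∀ m y, 0 < wt m y} {m j : ℕ} {hjm : j ≤ m}
    {hτ : 0 ≤ τ m j} {s : ℕ → ℝ} {H : Bg → C.Dom → ℝ} (hH : H ∈ Adm) {N : ℝ}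
    (hb : ∀ (U : Bg) (X : C.Dom), |H U X| ≤ Real.exp (-(κ * C.d X)) * N) (y : ι) :
    (Rd κ T wt Adm τ hadd hres hstep hsub hsmul hne hwt m j hjm hτ s ⟨embR κ H, embR_mem_sliceSub hH hb⟩ : ι → ℂ) y =
      ((T m s (restrictScale j H) y / wt m y : ℝ) : ℂ) := by
  rw [Rd_apply_coe, rdFun_apply]
  simp only [reF_embR hb, imF_embR hb, restrictScale_zero', channel_zero hadd hH]
  apply Complex.ext
  · simp only [Complex.mul_re, Complex.inv_re, Complex.ofReal_re, Complex.ofReal_im, Complex.normSq_ofReal, Complex.inv_im,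
      neg_zero, zero_div, zero_mul, sub_zero]
    have hw : wt m y ≠ 0 := (hwt m y).ne'
    field_simp
  · simp only [Complex.mul_im, Complex.inv_re, Complex.inv_im, Complex.ofReal_re, Complex.ofReal_im, neg_zero,
      Complex.normSq_ofReal, zero_div, zero_mul, mul_zero, add_zero]

/-! ## §5 Extension to the AMBIENT slice space (ℓ^∞ is injective: coordinatewise Hahn–Banach) — so that route R4's state space
can be the CLOSED ambient `lp (Bg × C.Dom → ℂ) ∞` and no closedness of the admissible class is needed -/

section Ext

variable {E : Type*} [SeminormedAddCommGroup E] [NormedSpace ℂ E] {ι : Type}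

/-- [folklore] DATA: coordinate evaluation of `lp (fun _ : ι => ℂ) ∞` at `y`, a bounded functional of norm `≤ 1`. -/
def evalι (y : ι) : lp (fun _ : ι => ℂ) ∞ →L[ℂ] ℂ :=
  LinearMap.mkContinuous
    { toFun := fun P => P y
      map_add' := fun P P' => by simp only [lp.coeFn_add, Pi.add_apply]
      map_smul' := fun z P => by simp only [lp.coeFn_smul, Pi.smul_apply, RingHom.id_apply] }
    1 fun P => by
      simp only [LinearMap.coe_mk, AddHom.coe_mk, one_mul]
      exact lp.norm_apply_le_norm ENNReal.top_ne_zero P y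

/-- [folklore] `evalι y P = P y`. -/
@[simp] theorem evalι_apply (y : ι) (P : lp (fun _ : ι => ℂ) ∞) : evalι y P = P y := rfl

/-- [folklore] `‖evalι y‖ ≤ 1`. -/
theorem norm_evalι_le (y : ι) : ‖(evalι y : lp (fun _ : ι => ℂ) ∞ →L[ℂ] ℂ)‖ ≤ 1 :=
  LinearMap.mkContinuous_norm_le _ zero_le_one _

/-- [folklore] DATA: a Hahn–Banach extension to `E` of the `y`-th coordinate functional of `A : p →L[ℂ] ℓ^∞(ι, ℂ)`. -/
def extCoord (p : Submodule ℂ E) (A : p →L[ℂ] lp (fun _ : ι => ℂ) ∞) (y : ι) : E →L[ℂ] ℂ :=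
  Classical.choose (exists_extension_norm_eq p ((evalι y).comp A))

/-- [folklore] The extension agrees with the coordinate functional on `p`. -/
theorem extCoord_apply_coe (p : Submodule ℂ E) (A : p →L[ℂ] lp (fun _ : ι => ℂ) ∞) (y : ι) (x : p) :
    extCoord p A y x = (A x : ι → ℂ) y :=
  (Classical.choose_spec (exists_extension_norm_eq p ((evalι y).comp A))).1 x

/-- [folklore] The extension has norm `≤ ‖A‖`. -/
theorem norm_extCoord_le (p : Submodule ℂ E) (A : p →L[ℂ] lp (fun _ : ι => ℂ) ∞) (y : ι) : ‖extCoord p A y‖ ≤ ‖A‖ := by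
  rw [extCoord, (Classical.choose_spec (exists_extension_norm_eq p ((evalι y).comp A))).2]
  exact (ContinuousLinearMap.opNorm_comp_le _ _).trans (by
    simpa only [one_mul] using mul_le_mul_of_nonneg_right (norm_evalι_le y) (norm_nonneg A))

/-- [folklore] The extended coordinates of `x` are bounded by `‖A‖·‖x‖`. -/
theorem memℓp_extCoord (p : Submodule ℂ E) (A : p →L[ℂ] lp (fun _ : ι => ℂ) ∞) (x : E) :
    Memℓp (fun y => extCoord p A y x) ∞ :=
  memℓp_infty ⟨‖A‖ * ‖x‖, by
    rintro _ ⟨y, rfl⟩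
    exact (extCoord p A y).le_of_opNorm_le (norm_extCoord_le p A y) x⟩

/-- **THE EXTENSION OF A BOUNDED LINEAR MAP INTO `ℓ^∞(ι, ℂ)` FROM A SUBSPACE TO THE WHOLE SPACE, SAME NORM BOUND**
(ℓ^∞ is an injective Banach space: extend each coordinate functional by Hahn–Banach and re-pack). [folklore] -/
def extCLM (p : Submodule ℂ E) (A : p →L[ℂ] lp (fun _ : ι => ℂ) ∞) : E →L[ℂ] lp (fun _ : ι => ℂ) ∞ :=
  LinearMap.mkContinuous
    { toFun := fun x => ⟨fun y => extCoord p A y x, memℓp_extCoord p A x⟩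
      map_add' := fun x x' => by
        ext y
        simp only [map_add, lp.coeFn_add, Pi.add_apply]
      map_smul' := fun z x => by
        ext y
        simp only [map_smul, lp.coeFn_smul, Pi.smul_apply, RingHom.id_apply] }
    ‖A‖ fun x => lp.norm_le_of_forall_le (mul_nonneg (norm_nonneg A) (norm_nonneg x)) fun y =>
      (extCoord p A y).le_of_opNorm_le (norm_extCoord_le p A y) x

/-- [folklore] The entries of the extension. -/
theorem extCLM_apply (p : Submodule ℂ E) (A : p →L[ℂ] lp (fun _ : ι => ℂ) ∞) (x : E) (y : ι) :
    (extCLM p A x : ι → ℂ) y = extCoord p A y x := rfl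

/-- **ON THE SUBSPACE THE EXTENSION IS `A`.** [folklore] -/
theorem extCLM_apply_coe (p : Submodule ℂ E) (A : p →L[ℂ] lp (fun _ : ι => ℂ) ∞) (x : p) :
    extCLM p A (x : E) = A x := by
  ext y
  rw [extCLM_apply, extCoord_apply_coe]

/-- **`‖extCLM p A‖ ≤ ‖A‖`.** [folklore] -/
theorem norm_extCLM_le (p : Submodule ℂ E) (A : p →L[ℂ] lp (fun _ : ι => ℂ) ∞) : ‖extCLM p A‖ ≤ ‖A‖ :=
  LinearMap.mkContinuous_norm_le _ (norm_nonneg A) _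

end Ext

/-! ## §6 The readings on the AMBIENT slice space `lp (Bg × C.Dom → ℂ) ∞` (route R4's 𝔜 := the closed ambient space) -/

section Ambient

variable {κ : ℝ} {T : ℕ → (ℕ → ℝ) → (Bg → C.Dom → ℝ) → ι → ℝ} {wt : ℕ → ι → ℝ} {Adm : Set (Bg → C.Dom → ℝ)}
  {τ : ℕ → ℕ → ℝ}

/-- **THE AMBIENT READINGS `RdAmb m j s : lp (Bg × C.Dom → ℂ) ∞ →L[ℂ] lp (ι → ℂ) ∞`** — the norm-preserving extension of `RdOf m j s`
from the slice space of record to the whole ambient space (K2♭'s `Rd` with `𝔜 :=` the ambient space). [folklore] -/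
def RdAmb (hadd : ChannelAdditive Adm T) (hres : AdmRestrict Adm) (hstep : ChannelSizeAtStepNN Adm T κ wt τ)
    (hsub : ∀ H₁ ∈ Adm, ∀ H₂ ∈ Adm, H₁ - H₂ ∈ Adm) (hsmul : ∀ (c : ℝ), ∀ H ∈ Adm, c • H ∈ Adm) (hne : Adm.Nonempty)
    (hwt : ∀ m y, 0 < wt m y) (hτ : ∀ m j, j ≤ m → 0 ≤ τ m j) (m j : ℕ) (s : ℕ → ℝ) :
    lp (fun _ : Bg × C.Dom => ℂ) ∞ →L[ℂ] lp (fun _ : ι => ℂ) ∞ :=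
  extCLM (sliceSub κ Adm hsub hsmul hne) (RdOf κ T wt Adm τ hadd hres hstep hsub hsmul hne hwt hτ m j s)

/-- **K2♭'s (B2) ON THE AMBIENT SPACE**: `‖RdAmb (j+n) j s‖ ≤ (√2·τ̄)·ωⁿ` under the record's geometric weights. [folklore] -/
theorem norm_RdAmb_le_geometric {hadd : ChannelAdditive Adm T} {hres : AdmRestrict Adm}
    {hstep : ChannelSizeAtStepNN Adm T κ wt τ} {hsub : ∀ H₁ ∈ Adm, ∀ H₂ ∈ Adm, H₁ - H₂ ∈ Adm}
    {hsmul : ∀ (c : ℝ), ∀ H ∈ Adm, c • H ∈ Adm} {hne : Adm.Nonempty} {hwt : ∀ m y, 0 < wt m y}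
    {hτ : ∀ m j, j ≤ m → 0 ≤ τ m j} {τbar ω : ℝ} (hgeom : ∀ m j, j ≤ m → τ m j ≤ τbar * ω ^ (m - j)) (j n : ℕ)
    (s : ℕ → ℝ) : ‖RdAmb (κ := κ) hadd hres hstep hsub hsmul hne hwt hτ (j + n) j s‖ ≤ Real.sqrt 2 * τbar * ω ^ n :=
  (norm_extCLM_le _ _).trans (norm_RdOf_le_geometric hgeom j n s)

/-- **ON THE SLICE SPACE OF RECORD THE AMBIENT READING IS `RdOf`.** [folklore] -/
theorem RdAmb_apply_coe {hadd : ChannelAdditive Adm T} {hres : AdmRestrict Adm} {hstep : ChannelSizeAtStepNN Adm T κ wt τ}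
    {hsub : ∀ H₁ ∈ Adm, ∀ H₂ ∈ Adm, H₁ - H₂ ∈ Adm} {hsmul : ∀ (c : ℝ), ∀ H ∈ Adm, c • H ∈ Adm} {hne : Adm.Nonempty}
    {hwt : ∀ m y, 0 < wt m y} {hτ : ∀ m j, j ≤ m → 0 ≤ τ m j} (m j : ℕ) (s : ℕ → ℝ) (G : sliceSub κ Adm hsub hsmul hne) :
    RdAmb hadd hres hstep hsub hsmul hne hwt hτ m j s (G : lp (fun _ : Bg × C.Dom => ℂ) ∞) =
      RdOf κ T wt Adm τ hadd hres hstep hsub hsmul hne hwt hτ m j s G :=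
  extCLM_apply_coe _ _ G

/-- **AT ACTUAL STATES: the ambient reading of an embedded real admissible family of finite size is the record's real weighted
table** `T m s (H↾j) y ∕ wt m y` (`j ≤ m`). [folklore] -/
theorem RdAmb_embR_apply {hadd : ChannelAdditive Adm T} {hres : AdmRestrict Adm} {hstep : ChannelSizeAtStepNN Adm T κ wt τ}
    {hsub : ∀ H₁ ∈ Adm, ∀ H₂ ∈ Adm, H₁ - H₂ ∈ Adm} {hsmul : ∀ (c : ℝ), ∀ H ∈ Adm, c • H ∈ Adm} {hne : Adm.Nonempty}
    {hwt : ∀ m y, 0 < wt m y} {hτ : ∀ m j, j ≤ m → 0 ≤ τ m j} {m j : ℕ} (hjm : j ≤ m) (s : ℕ → ℝ) {H : Bg → C.Dom → ℝ}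
    (hH : H ∈ Adm) {N : ℝ} (hb : ∀ (U : Bg) (X : C.Dom), |H U X| ≤ Real.exp (-(κ * C.d X)) * N) (y : ι) :
    (RdAmb hadd hres hstep hsub hsmul hne hwt hτ m j s (embR κ H) : ι → ℂ) y =
      ((T m s (restrictScale j H) y / wt m y : ℝ) : ℂ) := by
  have h := RdAmb_apply_coe (hadd := hadd) (hres := hres) (hstep := hstep) (hsub := hsub) (hsmul := hsmul) (hne := hne)
    (hwt := hwt) (hτ := hτ) m j s ⟨embR κ H, embR_mem_sliceSub hH hb⟩
  rw [Submodule.coe_mk] at h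
  rw [h, RdOf_of_le hjm, Rd_embR_apply hH hb]

end Ambient

end Summit.QuantumFields.BalabanUV.T4Continuum.NE9ChannelReadingOfRecord

end
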